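import Literature.Computability.AlgebraicComplexity.BI17Ex56ShapeSeven
import Literature.Computability.AlgebraicComplexity.KronRectElevenSix
import Literature.Computability.AlgebraicComplexity.KronRectOfLatinRectangles
import HarnessLib

/-!
# The generic minimal degree `e(m)` of `m × m × m` tensor invariants for `17 ≤ m ≤ 144`:
# the values the tree now decides (BI 2017 Problem 5.19, table extension; theorem-only)

P. Bürgisser, C. Ikenmeyer, *Fundamental invariants of orbit closures*, J. Algebra **477** (2017) §5
[BurgisserIkenmeyer2017]: `E(m) = {0} ∪ {mδ : k_m(δ) > 0}` is the degree monoid of generic tensors of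
format `m × m × m` (`genericTensorDegreeMonoid`, `genericTensorDegreeMonoid_eq_kronRect`) and
`e(m) = min (E(m) ∖ {0})` (`genericTensorMinimalDegree`); Ex. 5.6 lists `e(m)` for `m ≤ 12` and
Problem 5.19 asks for `e(m)` in general. The tree has `e(m)` for `m ≤ 16`, `19 ≤ m ≤ 22`, `24, 25,
27, 28`, `30 ≤ m ≤ 36`, `40`, `42 ≤ m ≤ 46`, `48, 49` and the generic near-square windows
`e(δ² − j) = (δ² − j)δ`, `j ≤ 6` (`BI17MinimalDegreeNearSquares`), `j ≤ δ` for `δ` even `≤ 24` /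
`δ = p ± 1` (`KronRectOfLatinRectangles`).

This THEOREM-ONLY file records the further values that the tree's rectangular Kronecker positivity
theorems now decide, all by the NEAR-SQUARE PRINCIPLE `genericTensorMinimalDegree_sq_sub_eq`
(`(δ−1)² < δ² − j = m ≤ δ²` and `k_j(δ) > 0 ⇒ e(m) = mδ`, through the complement symmetry
`k_j(δ) = k_{δ²−j}(δ)`) fed with: the semigroup property `kronRect_add_pos`, the square positivity
`kronRect_self_pos`, BI's table values `k_m(3), k_m(4)` (`BI17KronRectComplementSymmetry`), the
certified atoms `k_7(5) = 1456` (t08, `S_35` class sum), `k_7(6) > 0`, `k_11(6) > 0` (t03, design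
certificates), `k_10(5), k_10(6) > 0` (t08, mixed splitting), `k_j(8) > 0` for `j ≤ 14`, and the
Latin-rectangle bridge `LRC(n, δ) ⇒ k_n(δ) > 0`:

* `δ = 5`: **`e(18) = 90`** (`k_18(5) = k_7(5)`).
* `δ = 6`: **`e(26) = 156`**, **`e(29) = 174`** (`k_10(6)`, `k_7(6)`) — the window `26 ≤ m ≤ 36` is
  now complete.
* `δ = 7`: **`e(41) = 287`** (`k_8(7) = k_8(3 + 4)`).
* `δ = 8`: **`e(64 − j) = 8(64 − j)` for `1 ≤ j ≤ 14`**, i.e. `e(50), …, e(63) = 400, …, 504`.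
* `δ = 9`: **`e(m) = 9m` for `m ∈ {66, 71, 72, 73, 74, 75, 76, 77, 78, 80}`** and the odd anomaly
  **`e(79) = 790 = 79·10`** (`k_2(9) = 0`, `k_79(10) = k_21(10) = k_21(5 + 5)`, `k_21(5) = k_4(5)`).
* `δ = 10`: **`e(82) = 820`, `e(85) = 850`, `e(88) = 880`, `e(89) = 890`** (beyond the `LRC` window
  `90 ≤ m ≤ 100`: `k_18(10) = k_18(5+5)`, `k_15(10)`, `k_12(10) = k_12(4+6)`, `k_11(10) = k_11(4+6)`).
* `δ = 11`: **`e(m) = 11m` for `110 ≤ m ≤ 118` and `m = 120`**, and the odd anomaly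
  **`e(119) = 1428 = 119·12`** (`k_2(11) = 0`; `k_119(12) = k_25(12) = k_25(6 + 6)`, `k_25(6) = k_11(6)`).
* `δ = 12`: **`e(m) = 12m` for `128 ≤ m ≤ 131`** (`k_j(12) = k_j(4+4+4)`, `13 ≤ j ≤ 16`), next to the
  `LRC` window `132 ≤ m ≤ 144`.

SETTLED SINCE in sibling files (update 2026-08-27, seat t04 g9): `e(17) = 85` and `e(83) = 830`
(`BI17MinimalDegreeSeventeen`, from `k_8(5) = 9854`), **`e(23) = 138`** (`KronRectThirteenSix`: the atom
`k_13(6) > 0` by a kernel-checked memoised design certificate, and `BI17MinimalDegreeTwentyThreeIff`),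
`e(87) = 870` (`BI17KronRectThirteenColumn`: `k_13(10) = k_13(4 + 6)`).
STILL OPEN in this range (honest list): `e(37), e(38), e(39)` (the odd-`δ` atoms `k_12(7)`, `k_11(7)`,
`k_10(7)` of `BI2017_ex_5_6`), `e(47)` (`376 ≤ e(47)`; `= 376 ⇔ k_17(8) > 0`), `e(65)`, `e(67), …, e(70)`
(`k_16(9), k_14(9), …, k_11(9)`), `e(86)` and `e(84)` (the `δ = 10` indices `j = 14, 16`:
`k_14(10)`, `k_16(10)`), `e(101), …, e(109)`, `e(121 + r)` for `j ∈ {17, …, 22}` (`m = 122, …, 127`).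

Honest framing (cell `val-lit`, row BI2017-B): bookkeeping of BI's Problem 5.19 from the tree's own
theorems; no named fact moves; VP ≠ VNP is NOT proved and nothing here bears on it. No definitions,
no named facts.

## References

* [BurgisserIkenmeyer2017] P. Bürgisser, C. Ikenmeyer, J. Algebra 477 (2017) 390–434 =
  arXiv:1511.02927, §5: eq. (5.2) (`E(m)`, `k_m(δ)`), Ex. 5.6 (the table `m ≤ 12`), Rem. 5.18,
  Problem 5.19 ("determine `e(m)`").
* [AmanovYeliussizov2022] A. Amanov, D. Yeliussizov, arXiv:2202.11059, Thm. 5.1 (ii) (complement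
  symmetry), Rem. 5.9 / 8.8 (the near-square principle), §9 Table 4.
-/

noncomputable section

namespace Literature.Computability.AlgebraicComplexity

/-! ### §0 Two pieces of plumbing -/

/-- `e(m) ≤ mδ` whenever `k_m(δ) > 0` (`mδ ∈ E(m) ∖ {0}`). [cite: BurgisserIkenmeyer2017, §5 eq. (5.2)] -/
theorem genericTensorMinimalDegree_le_of_kronRect_pos {m δ : ℕ} (hm : 0 < m) (hδ : 0 < δ)
    (h : 0 < kronRect ℂ m δ) : genericTensorMinimalDegree (Fin m) ℂ ≤ m * δ := by
  refine Nat.sInf_le ⟨?_, Nat.mul_pos hm hδ⟩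
  rw [genericTensorDegreeMonoid_eq_kronRect m]
  exact ⟨δ, rfl, h⟩

/-- `k_m(δ₁ + δ₂ + δ₃) > 0` from three positive summands (the semigroup property twice).
[cite: BurgisserIkenmeyer2017, Rem. 5.18] -/
theorem kronRect_add_add_pos {m δ₁ δ₂ δ₃ : ℕ} (hm : 0 < m) (h₁ : 0 < kronRect ℂ m δ₁)
    (h₂ : 0 < kronRect ℂ m δ₂) (h₃ : 0 < kronRect ℂ m δ₃) : 0 < kronRect ℂ m (δ₁ + δ₂ + δ₃) :=
  kronRect_add_pos hm (kronRect_add_pos hm h₁ h₂) h₃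

/-! ### §1 The windows `δ = 5, 6, 7`: `e(18)`, `e(26)`, `e(29)`, `e(41)` -/

/-- `k_18(5) > 0` (`= k_7(5) = 1456` by the complement symmetry). [cite: BurgisserIkenmeyer2017, Ex. 5.6] -/
theorem kronRect_eighteen_five_pos : 0 < kronRect ℂ 18 5 :=
  kronRect_sq_sub_pos (δ := 5) (j := 7) (by norm_num) kronRect_seven_five_pos

/-- **`e(18) = 90`** (`δ = 5`, `k_7(5) > 0`). [cite: BurgisserIkenmeyer2017, Ex. 5.6 and Problem 5.19] -/
theorem genericTensorMinimalDegree_eighteen : genericTensorMinimalDegree (Fin 18) ℂ = 90 :=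
  genericTensorMinimalDegree_sq_sub_eq (δ := 5) (j := 7) (by norm_num) kronRect_seven_five_pos

/-- **`e(26) = 156` and `e(29) = 174`** (`δ = 6`: `k_10(6) > 0`, `k_7(6) > 0`), completing the window
`26 ≤ m ≤ 36` (`e(27) = 162`, `e(28) = 168`, `e(30), …, e(36)` are in `BI17MinimalDegreeNearSquares`).
[cite: BurgisserIkenmeyer2017, Ex. 5.6 and Problem 5.19] -/
theorem genericTensorMinimalDegree_twentySix_twentyNine :
    genericTensorMinimalDegree (Fin 26) ℂ = 156 ∧ genericTensorMinimalDegree (Fin 29) ℂ = 174 :=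
  ⟨genericTensorMinimalDegree_sq_sub_eq (δ := 6) (j := 10) (by norm_num) kronRect_ten_six_pos,
    genericTensorMinimalDegree_sq_sub_eq (δ := 6) (j := 7) (by norm_num) (kronRect_seven_six_pos ℂ)⟩

/-- `k_8(7) > 0` (`7 = 3 + 4`, `k_8(3), k_8(4) > 0`). [cite: BurgisserIkenmeyer2017, Ex. 5.6 and Rem. 5.18] -/
theorem kronRect_eight_seven_pos : 0 < kronRect ℂ 8 7 :=
  kronRect_add_pos (δ₁ := 3) (δ₂ := 4) (by norm_num) kronRect_eight_three_pos kronRect_eight_four_pos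

/-- `k_8(δ) > 0` for every `δ ≥ 6` WITHOUT the atom `k_8(5)` (window `6, 7, 8 = 3+3, 3+4, 4+4`; with
`k_8(5) > 0` — the `S_40` class sum — this becomes "every `δ ≥ 3`", BI's `E'(8) = {0,3,4,5,…}`).
[cite: BurgisserIkenmeyer2017, Ex. 5.6] -/
theorem kronRect_eight_pos_of_six_le {δ : ℕ} (hδ : 6 ≤ δ) : 0 < kronRect ℂ 8 δ := by
  refine kronRect_pos_of_window (m := 8) (δ₀ := 6) (by norm_num) (by norm_num) (fun δ h1 h2 => ?_) δ hδ
  interval_cases δ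
  · exact kronRect_add_pos (δ₁ := 3) (δ₂ := 3) (by norm_num) kronRect_eight_three_pos
      kronRect_eight_three_pos
  · exact kronRect_eight_seven_pos
  · exact kronRect_self_pos 8 (by norm_num)
  · exact kronRect_add_add_pos (δ₁ := 3) (δ₂ := 3) (δ₃ := 3) (by norm_num) kronRect_eight_three_pos
      kronRect_eight_three_pos kronRect_eight_three_pos
  · exact kronRect_add_add_pos (δ₁ := 3) (δ₂ := 3) (δ₃ := 4) (by norm_num) kronRect_eight_three_pos
      kronRect_eight_three_pos kronRect_eight_four_pos
  · exact kronRect_add_add_pos (δ₁ := 3) (δ₂ := 4) (δ₃ := 4) (by norm_num) kronRect_eight_three_pos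
      kronRect_eight_four_pos kronRect_eight_four_pos

/-- **`e(41) = 287`** (`δ = 7`, `k_8(7) > 0`); `e(37), e(38), e(39)` wait on the odd-`δ` atoms
`k_12(7), k_11(7), k_10(7)`. [cite: BurgisserIkenmeyer2017, Ex. 5.6 and Problem 5.19] -/
theorem genericTensorMinimalDegree_fortyOne : genericTensorMinimalDegree (Fin 41) ℂ = 287 :=
  genericTensorMinimalDegree_sq_sub_eq (δ := 7) (j := 8) (by norm_num) kronRect_eight_seven_pos

/-! ### §2 The window `δ = 8`: `e(50), …, e(63)` -/

/-- **`e(64 − j) = 8(64 − j)` for `1 ≤ j ≤ 14`** (`k_j(8) > 0`, `kronRect_eight_pos_of_le_fourteen`).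
[cite: BurgisserIkenmeyer2017, Problem 5.19] -/
theorem genericTensorMinimalDegree_delta_eight {j : ℕ} (h1 : 1 ≤ j) (h14 : j ≤ 14) :
    genericTensorMinimalDegree (Fin (8 * 8 - j)) ℂ = (8 * 8 - j) * 8 :=
  genericTensorMinimalDegree_sq_sub_eq (by omega) (kronRect_eight_pos_of_le_fourteen h1 h14)

/-- The window `δ = 8` spelled out: `e(50) = 400`, `e(51) = 408`, …, `e(63) = 504`.
[cite: BurgisserIkenmeyer2017, Problem 5.19] -/
theorem genericTensorMinimalDegree_fifty_to_sixtyThree :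
    genericTensorMinimalDegree (Fin 50) ℂ = 400 ∧ genericTensorMinimalDegree (Fin 51) ℂ = 408 ∧
    genericTensorMinimalDegree (Fin 52) ℂ = 416 ∧ genericTensorMinimalDegree (Fin 53) ℂ = 424 ∧
    genericTensorMinimalDegree (Fin 54) ℂ = 432 ∧ genericTensorMinimalDegree (Fin 55) ℂ = 440 ∧
    genericTensorMinimalDegree (Fin 56) ℂ = 448 ∧ genericTensorMinimalDegree (Fin 57) ℂ = 456 ∧
    genericTensorMinimalDegree (Fin 58) ℂ = 464 ∧ genericTensorMinimalDegree (Fin 59) ℂ = 472 ∧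
    genericTensorMinimalDegree (Fin 60) ℂ = 480 ∧ genericTensorMinimalDegree (Fin 61) ℂ = 488 ∧
    genericTensorMinimalDegree (Fin 62) ℂ = 496 ∧ genericTensorMinimalDegree (Fin 63) ℂ = 504 :=
  ⟨genericTensorMinimalDegree_delta_eight (j := 14) (by norm_num) (by norm_num),
    genericTensorMinimalDegree_delta_eight (j := 13) (by norm_num) (by norm_num),
    genericTensorMinimalDegree_delta_eight (j := 12) (by norm_num) (by norm_num),
    genericTensorMinimalDegree_delta_eight (j := 11) (by norm_num) (by norm_num),
    genericTensorMinimalDegree_delta_eight (j := 10) (by norm_num) (by norm_num),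
    genericTensorMinimalDegree_delta_eight (j := 9) (by norm_num) (by norm_num),
    genericTensorMinimalDegree_delta_eight (j := 8) (by norm_num) (by norm_num),
    genericTensorMinimalDegree_delta_eight (j := 7) (by norm_num) (by norm_num),
    genericTensorMinimalDegree_delta_eight (j := 6) (by norm_num) (by norm_num),
    genericTensorMinimalDegree_delta_eight (j := 5) (by norm_num) (by norm_num),
    genericTensorMinimalDegree_delta_eight (j := 4) (by norm_num) (by norm_num),
    genericTensorMinimalDegree_delta_eight (j := 3) (by norm_num) (by norm_num),
    genericTensorMinimalDegree_delta_eight (j := 2) (by norm_num) (by norm_num),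
    genericTensorMinimalDegree_delta_eight (j := 1) (by norm_num) (by norm_num)⟩

/-! ### §3 The window `δ = 9`: `e(66)`, `e(71), …, e(78)`, `e(80)` and the anomaly `e(79) = 790` -/

/-- `k_8(9) > 0` (`9 = 3 + 3 + 3`). [cite: BurgisserIkenmeyer2017, Rem. 5.18] -/
theorem kronRect_eight_nine_pos : 0 < kronRect ℂ 8 9 := kronRect_eight_pos_of_six_le (by norm_num)

/-- `k_9(δ) > 0` for every `δ ≥ 6` WITHOUT the atom `k_9(5)` (`k_9(3) = 1`, `k_9(4) = 14`; window
`6, 7, 8 = 3+3, 3+4, 4+4`). [cite: BurgisserIkenmeyer2017, Ex. 5.6 and Rem. 5.18] -/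
theorem kronRect_nine_pos_of_six_le {δ : ℕ} (hδ : 6 ≤ δ) : 0 < kronRect ℂ 9 δ := by
  have h3 : 0 < kronRect ℂ 9 3 := by rw [BI2017_rem_5_18_squares.2.1]; norm_num
  have h4 : 0 < kronRect ℂ 9 4 := by rw [kronRect_nine_four]; norm_num
  refine kronRect_pos_of_window (m := 9) (δ₀ := 6) (by norm_num) (by norm_num) (fun δ h1 h2 => ?_) δ hδ
  interval_cases δ
  · exact kronRect_add_pos (δ₁ := 3) (δ₂ := 3) (by norm_num) h3 h3
  · exact kronRect_add_pos (δ₁ := 3) (δ₂ := 4) (by norm_num) h3 h4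
  · exact kronRect_add_pos (δ₁ := 4) (δ₂ := 4) (by norm_num) h4 h4
  · exact kronRect_self_pos 9 (by norm_num)
  · exact kronRect_add_add_pos (δ₁ := 3) (δ₂ := 3) (δ₃ := 4) (by norm_num) h3 h3 h4
  · exact kronRect_add_add_pos (δ₁ := 3) (δ₂ := 4) (δ₃ := 4) (by norm_num) h3 h4 h4

/-- `k_10(δ) > 0` for every `δ ≥ 8` WITHOUT the atom `k_10(7)` (`k_10(4) = 13`, `k_10(5), k_10(6) > 0`;
window `8, …, 15`). [cite: BurgisserIkenmeyer2017, Ex. 5.6 and Rem. 5.18] -/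
theorem kronRect_ten_pos_of_eight_le {δ : ℕ} (hδ : 8 ≤ δ) : 0 < kronRect ℂ 10 δ := by
  have h4 : 0 < kronRect ℂ 10 4 := by rw [kronRect_ten_four]; norm_num
  have h5 : 0 < kronRect ℂ 10 5 := kronRect_ten_five_pos
  have h6 : 0 < kronRect ℂ 10 6 := kronRect_ten_six_pos
  have h8 : 0 < kronRect ℂ 10 8 := kronRect_add_pos (δ₁ := 4) (δ₂ := 4) (by norm_num) h4 h4
  have h9 : 0 < kronRect ℂ 10 9 := kronRect_add_pos (δ₁ := 4) (δ₂ := 5) (by norm_num) h4 h5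
  have h10 : 0 < kronRect ℂ 10 10 := kronRect_add_pos (δ₁ := 4) (δ₂ := 6) (by norm_num) h4 h6
  have h11 : 0 < kronRect ℂ 10 11 := kronRect_add_pos (δ₁ := 5) (δ₂ := 6) (by norm_num) h5 h6
  refine kronRect_pos_of_window (m := 10) (δ₀ := 8) (by norm_num) (by norm_num) (fun δ h1 h2 => ?_) δ hδ
  interval_cases δ
  · exact h8
  · exact h9
  · exact h10
  · exact h11
  · exact kronRect_add_pos (δ₁ := 4) (δ₂ := 8) (by norm_num) h4 h8
  · exact kronRect_add_pos (δ₁ := 4) (δ₂ := 9) (by norm_num) h4 h9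
  · exact kronRect_add_pos (δ₁ := 4) (δ₂ := 10) (by norm_num) h4 h10
  · exact kronRect_add_pos (δ₁ := 4) (δ₂ := 11) (by norm_num) h4 h11

/-- `k_15(5) > 0` (`= k_10(5)`), `k_18(5) > 0` (`= k_7(5)`), `k_21(5) > 0` (`= k_4(5)`): the
complements in the box `δ = 5`. [cite: BurgisserIkenmeyer2017, §5 eq. (5.2)] -/
theorem kronRect_fifteen_twentyOne_five_pos : 0 < kronRect ℂ 15 5 ∧ 0 < kronRect ℂ 21 5 :=
  ⟨kronRect_sq_sub_pos (δ := 5) (j := 10) (by norm_num) kronRect_ten_five_pos,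
    kronRect_sq_sub_pos (δ := 5) (j := 4) (by norm_num) (kronRect_four_pos (by norm_num))⟩

/-- `k_15(9) > 0` (`9 = 4 + 5`: `k_15(4) = 1`, `k_15(5) = k_10(5) > 0`). [cite: BurgisserIkenmeyer2017, Rem. 5.18] -/
theorem kronRect_fifteen_nine_pos : 0 < kronRect ℂ 15 9 :=
  kronRect_add_pos (δ₁ := 4) (δ₂ := 5) (by norm_num) (by rw [kronRect_fifteen_four]; norm_num)
    kronRect_fifteen_twentyOne_five_pos.1

/-- **The window `δ = 9`**: `e(66) = 594`, `e(71) = 639`, `e(72) = 648`, `e(73) = 657`, `e(74) = 666`,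
`e(75) = 675`, `e(76) = 684`, `e(77) = 693`, `e(78) = 702`, `e(80) = 720` (`k_j(9) > 0` for
`j = 15, 10, 9, 8, 7, 6, 5, 4, 3, 1`); `e(65), e(67), …, e(70)` wait on `k_16(9), k_14(9), …, k_11(9)`.
[cite: BurgisserIkenmeyer2017, Problem 5.19] -/
theorem genericTensorMinimalDegree_delta_nine :
    genericTensorMinimalDegree (Fin 66) ℂ = 594 ∧ genericTensorMinimalDegree (Fin 71) ℂ = 639 ∧
    genericTensorMinimalDegree (Fin 72) ℂ = 648 ∧ genericTensorMinimalDegree (Fin 73) ℂ = 657 ∧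
    genericTensorMinimalDegree (Fin 74) ℂ = 666 ∧ genericTensorMinimalDegree (Fin 75) ℂ = 675 ∧
    genericTensorMinimalDegree (Fin 76) ℂ = 684 ∧ genericTensorMinimalDegree (Fin 77) ℂ = 693 ∧
    genericTensorMinimalDegree (Fin 78) ℂ = 702 ∧ genericTensorMinimalDegree (Fin 80) ℂ = 720 :=
  ⟨genericTensorMinimalDegree_sq_sub_eq (δ := 9) (j := 15) (by norm_num) kronRect_fifteen_nine_pos,
    genericTensorMinimalDegree_sq_sub_eq (δ := 9) (j := 10) (by norm_num)
      (kronRect_ten_pos_of_eight_le (by norm_num)),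
    genericTensorMinimalDegree_sq_sub_eq (δ := 9) (j := 9) (by norm_num) (kronRect_self_pos 9 (by norm_num)),
    genericTensorMinimalDegree_sq_sub_eq (δ := 9) (j := 8) (by norm_num) kronRect_eight_nine_pos,
    genericTensorMinimalDegree_sq_sub_eq (δ := 9) (j := 7) (by norm_num)
      (kronRect_seven_pos_of_four_le (by norm_num)),
    genericTensorMinimalDegree_sq_sub_eq (δ := 9) (j := 6) (by norm_num)
      (kronRect_six_pos_of_three_le (by norm_num)),
    genericTensorMinimalDegree_sq_sub_eq (δ := 9) (j := 5) (by norm_num)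
      (kronRect_five_pos_of_three_le (by norm_num)),
    genericTensorMinimalDegree_sq_sub_eq (δ := 9) (j := 4) (by norm_num) (kronRect_four_pos (by norm_num)),
    genericTensorMinimalDegree_sq_sub_eq (δ := 9) (j := 3) (by norm_num) (kronRect_three_pos (by norm_num)),
    genericTensorMinimalDegree_sq_sub_eq (δ := 9) (j := 1) (by norm_num) (kronRect_one_pos 9)⟩

/-- `k_79(10) > 0` (`= k_21(10)`, `21 + 79 = 10²`; `k_21(10) = k_21(5 + 5)`, `k_21(5) = k_4(5) > 0`).
[cite: BurgisserIkenmeyer2017, §5 eq. (5.2) and Rem. 5.18] -/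
theorem kronRect_seventyNine_ten_pos : 0 < kronRect ℂ 79 10 :=
  kronRect_sq_sub_pos (δ := 10) (j := 21) (by norm_num)
    (kronRect_add_pos (δ₁ := 5) (δ₂ := 5) (by norm_num) kronRect_fifteen_twentyOne_five_pos.2
      kronRect_fifteen_twentyOne_five_pos.2)

/-- **The odd anomaly at `δ = 9`: `e(79) = 790 = 79·10`** (`9 ∉ E'(79)` since `k_2(9) = 0`, and
`10 ∈ E'(79)`) — BI's `e(7) = 7·4` pattern (`e'(δ² − 2) = δ + 1` for odd `δ`) at `δ = 9`; at `δ = 5, 7`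
(`e(23)`, `e(47)`) the upper bound is still open. [cite: BurgisserIkenmeyer2017, Ex. 5.6 and Problem 5.19] -/
theorem genericTensorMinimalDegree_seventyNine : genericTensorMinimalDegree (Fin 79) ℂ = 790 :=
  le_antisymm
    (genericTensorMinimalDegree_le_of_kronRect_pos (by norm_num) (by norm_num) kronRect_seventyNine_ten_pos)
    (le_genericTensorMinimalDegree_sq_sub_two_of_odd (δ := 9) (by norm_num) (by decide))

/-! ### §4 The window `δ = 10`: `e(82)`, `e(85)`, `e(88)`, `e(89)` beyond the `LRC` values `e(90), …, e(100)` -/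

/-- `k_11(10) > 0` (`10 = 4 + 6`: `k_11(4) = 6`, `k_11(6) > 0`) and `k_12(10) > 0` (`k_12(4) = 5`,
`k_12(6) > 0`). [cite: BurgisserIkenmeyer2017, Ex. 5.6 and Rem. 5.18] -/
theorem kronRect_eleven_twelve_ten_pos : 0 < kronRect ℂ 11 10 ∧ 0 < kronRect ℂ 12 10 :=
  ⟨kronRect_add_pos (δ₁ := 4) (δ₂ := 6) (by norm_num) (by rw [kronRect_eleven_four]; norm_num)
      (kronRect_eleven_six_pos ℂ),
    kronRect_add_pos (δ₁ := 4) (δ₂ := 6) (by norm_num) (by rw [kronRect_twelve_four]; norm_num)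
      kronRect_twelve_six_pos⟩

/-- `k_15(10) > 0` (`= k_15(5 + 5)`) and `k_18(10) > 0` (`= k_18(5 + 5)`).
[cite: BurgisserIkenmeyer2017, Rem. 5.18] -/
theorem kronRect_fifteen_eighteen_ten_pos : 0 < kronRect ℂ 15 10 ∧ 0 < kronRect ℂ 18 10 :=
  ⟨kronRect_add_pos (δ₁ := 5) (δ₂ := 5) (by norm_num) kronRect_fifteen_twentyOne_five_pos.1
      kronRect_fifteen_twentyOne_five_pos.1,
    kronRect_add_pos (δ₁ := 5) (δ₂ := 5) (by norm_num) kronRect_eighteen_five_pos kronRect_eighteen_five_pos⟩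

/-- **The window `δ = 10`**: `e(82) = 820`, `e(85) = 850`, `e(88) = 880`, `e(89) = 890`, and — from
the Latin-rectangle bridge (`δ = 10 = 11 − 1`, Glynn) — `e(90) = 900`, …, `e(99) = 990`,
`e(100) = 1000`; `e(83)` waits on `k_8(5)` (`k_17(5) = k_8(5)`), `e(84), e(86), e(87)` on
`k_16(10), k_14(10), k_13(10)`. [cite: BurgisserIkenmeyer2017, Problem 5.19] -/
theorem genericTensorMinimalDegree_delta_ten :
    genericTensorMinimalDegree (Fin 82) ℂ = 820 ∧ genericTensorMinimalDegree (Fin 85) ℂ = 850 ∧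
    genericTensorMinimalDegree (Fin 88) ℂ = 880 ∧ genericTensorMinimalDegree (Fin 89) ℂ = 890 ∧
    genericTensorMinimalDegree (Fin 90) ℂ = 900 ∧ genericTensorMinimalDegree (Fin 95) ℂ = 950 ∧
    genericTensorMinimalDegree (Fin 99) ℂ = 990 ∧ genericTensorMinimalDegree (Fin 100) ℂ = 1000 :=
  ⟨genericTensorMinimalDegree_sq_sub_eq (δ := 10) (j := 18) (by norm_num) kronRect_fifteen_eighteen_ten_pos.2,
    genericTensorMinimalDegree_sq_sub_eq (δ := 10) (j := 15) (by norm_num) kronRect_fifteen_eighteen_ten_pos.1,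
    genericTensorMinimalDegree_sq_sub_eq (δ := 10) (j := 12) (by norm_num) kronRect_eleven_twelve_ten_pos.2,
    genericTensorMinimalDegree_sq_sub_eq (δ := 10) (j := 11) (by norm_num) kronRect_eleven_twelve_ten_pos.1,
    genericTensorMinimalDegree_sq_sub_eq_prime_sub_one (p := 11) (j := 10) (by norm_num) (by decide)
      (by norm_num),
    genericTensorMinimalDegree_sq_sub_eq_prime_sub_one (p := 11) (j := 5) (by norm_num) (by decide)
      (by norm_num),
    genericTensorMinimalDegree_sq_sub_eq_prime_sub_one (p := 11) (j := 1) (by norm_num) (by decide)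
      (by norm_num),
    genericTensorMinimalDegree_sq_sub_eq_prime_sub_one (p := 11) (j := 0) (by norm_num) (by decide)
      (by norm_num)⟩

/-! ### §5 The window `δ = 11`: `e(110), …, e(118)`, `e(120)` and the anomaly `e(119) = 1428` -/

/-- `k_j(11) > 0` for `j ∈ {8, 9, 10}` (`11 = 8 + 3 = 4 + 4 + 3 = 5 + 6`).
[cite: BurgisserIkenmeyer2017, Ex. 5.6 and Rem. 5.18] -/
theorem kronRect_eight_nine_ten_eleven_pos :
    0 < kronRect ℂ 8 11 ∧ 0 < kronRect ℂ 9 11 ∧ 0 < kronRect ℂ 10 11 :=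
  ⟨kronRect_eight_pos_of_six_le (by norm_num), kronRect_nine_pos_of_six_le (by norm_num),
    kronRect_ten_pos_of_eight_le (by norm_num)⟩

/-- **The window `δ = 11`**: `e(110) = 1210`, `e(111) = 1221`, `e(112) = 1232`, `e(113) = 1243`,
`e(114) = 1254`, `e(115) = 1265`, `e(116) = 1276`, `e(117) = 1287`, `e(118) = 1298`, `e(120) = 1320`
(`k_j(11) > 0` for `j = 11, 10, …, 3` and `j = 1`); `e(101), …, e(109)` wait on `k_20(11), …, k_12(11)`.
[cite: BurgisserIkenmeyer2017, Problem 5.19] -/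
theorem genericTensorMinimalDegree_delta_eleven :
    genericTensorMinimalDegree (Fin 110) ℂ = 1210 ∧ genericTensorMinimalDegree (Fin 111) ℂ = 1221 ∧
    genericTensorMinimalDegree (Fin 112) ℂ = 1232 ∧ genericTensorMinimalDegree (Fin 113) ℂ = 1243 ∧
    genericTensorMinimalDegree (Fin 114) ℂ = 1254 ∧ genericTensorMinimalDegree (Fin 115) ℂ = 1265 ∧
    genericTensorMinimalDegree (Fin 116) ℂ = 1276 ∧ genericTensorMinimalDegree (Fin 117) ℂ = 1287 ∧
    genericTensorMinimalDegree (Fin 118) ℂ = 1298 ∧ genericTensorMinimalDegree (Fin 120) ℂ = 1320 :=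
  ⟨genericTensorMinimalDegree_sq_sub_eq (δ := 11) (j := 11) (by norm_num) (kronRect_self_pos 11 (by norm_num)),
    genericTensorMinimalDegree_sq_sub_eq (δ := 11) (j := 10) (by norm_num)
      kronRect_eight_nine_ten_eleven_pos.2.2,
    genericTensorMinimalDegree_sq_sub_eq (δ := 11) (j := 9) (by norm_num)
      kronRect_eight_nine_ten_eleven_pos.2.1,
    genericTensorMinimalDegree_sq_sub_eq (δ := 11) (j := 8) (by norm_num)
      kronRect_eight_nine_ten_eleven_pos.1,
    genericTensorMinimalDegree_sq_sub_eq (δ := 11) (j := 7) (by norm_num)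
      (kronRect_seven_pos_of_four_le (by norm_num)),
    genericTensorMinimalDegree_sq_sub_eq (δ := 11) (j := 6) (by norm_num)
      (kronRect_six_pos_of_three_le (by norm_num)),
    genericTensorMinimalDegree_sq_sub_eq (δ := 11) (j := 5) (by norm_num)
      (kronRect_five_pos_of_three_le (by norm_num)),
    genericTensorMinimalDegree_sq_sub_eq (δ := 11) (j := 4) (by norm_num) (kronRect_four_pos (by norm_num)),
    genericTensorMinimalDegree_sq_sub_eq (δ := 11) (j := 3) (by norm_num) (kronRect_three_pos (by norm_num)),
    genericTensorMinimalDegree_sq_sub_eq (δ := 11) (j := 1) (by norm_num) (kronRect_one_pos 11)⟩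

/-- `k_119(12) > 0` (`= k_25(12)`, `25 + 119 = 12²`; `k_25(12) = k_25(6 + 6)`, `k_25(6) = k_11(6) > 0`).
[cite: BurgisserIkenmeyer2017, §5 eq. (5.2) and Rem. 5.18] -/
theorem kronRect_hundredNineteen_twelve_pos : 0 < kronRect ℂ 119 12 := by
  have h25 : 0 < kronRect ℂ 25 6 :=
    kronRect_sq_sub_pos (δ := 6) (j := 11) (by norm_num) (kronRect_eleven_six_pos ℂ)
  exact kronRect_sq_sub_pos (δ := 12) (j := 25) (by norm_num)
    (kronRect_add_pos (δ₁ := 6) (δ₂ := 6) (by norm_num) h25 h25)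

/-- **The odd anomaly at `δ = 11`: `e(119) = 1428 = 119·12`** (`k_2(11) = 0` excludes `11 ∈ E'(119)`;
`12 ∈ E'(119)` by `k_119(12) = k_25(12) > 0`). [cite: BurgisserIkenmeyer2017, Ex. 5.6 and Problem 5.19] -/
theorem genericTensorMinimalDegree_hundredNineteen : genericTensorMinimalDegree (Fin 119) ℂ = 1428 :=
  le_antisymm
    (genericTensorMinimalDegree_le_of_kronRect_pos (by norm_num) (by norm_num)
      kronRect_hundredNineteen_twelve_pos)
    (le_genericTensorMinimalDegree_sq_sub_two_of_odd (δ := 11) (by norm_num) (by decide))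

/-! ### §6 The window `δ = 12`: `e(128), …, e(131)` next to the `LRC` values `e(132), …, e(144)` -/

/-- `k_j(12) > 0` for `13 ≤ j ≤ 16` (`12 = 4 + 4 + 4`; `k_13(4) = 2`, `k_14(4) = k_15(4) = k_16(4) = 1`).
[cite: BurgisserIkenmeyer2017, Ex. 5.6 and Rem. 5.18] -/
theorem kronRect_twelve_pos_of_thirteen_le_sixteen {j : ℕ} (h13 : 13 ≤ j) (h16 : j ≤ 16) :
    0 < kronRect ℂ j 12 := by
  have key : ∀ j', 0 < j' → 0 < kronRect ℂ j' 4 → 0 < kronRect ℂ j' 12 :=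
    fun j' hj' h => kronRect_add_add_pos (δ₁ := 4) (δ₂ := 4) (δ₃ := 4) hj' h h h
  interval_cases j
  · exact key 13 (by norm_num) (by rw [kronRect_thirteen_four]; norm_num)
  · exact key 14 (by norm_num) (by rw [kronRect_fourteen_four]; norm_num)
  · exact key 15 (by norm_num) (by rw [kronRect_fifteen_four]; norm_num)
  · exact key 16 (by norm_num) (by rw [BI2017_rem_5_18_squares.2.2]; norm_num)

/-- **The window `δ = 12`**: `e(128) = 1536`, `e(129) = 1548`, `e(130) = 1560`, `e(131) = 1572`, and —
from the Latin-rectangle bridge (`δ = 12 = 11 + 1 = 13 − 1`) — `e(132) = 1584`, `e(138) = 1656`,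
`e(143) = 1716`, `e(144) = 1728` (all `e(144 − j)`, `j ≤ 12`, by
`genericTensorMinimalDegree_sq_sub_eq_prime_add_one`); `e(122), …, e(127)` wait on
`k_22(12), …, k_17(12)`. [cite: BurgisserIkenmeyer2017, Problem 5.19] -/
theorem genericTensorMinimalDegree_delta_twelve :
    genericTensorMinimalDegree (Fin 128) ℂ = 1536 ∧ genericTensorMinimalDegree (Fin 129) ℂ = 1548 ∧
    genericTensorMinimalDegree (Fin 130) ℂ = 1560 ∧ genericTensorMinimalDegree (Fin 131) ℂ = 1572 ∧
    genericTensorMinimalDegree (Fin 132) ℂ = 1584 ∧ genericTensorMinimalDegree (Fin 138) ℂ = 1656 ∧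
    genericTensorMinimalDegree (Fin 143) ℂ = 1716 ∧ genericTensorMinimalDegree (Fin 144) ℂ = 1728 :=
  ⟨genericTensorMinimalDegree_sq_sub_eq (δ := 12) (j := 16) (by norm_num)
      (kronRect_twelve_pos_of_thirteen_le_sixteen (by norm_num) (by norm_num)),
    genericTensorMinimalDegree_sq_sub_eq (δ := 12) (j := 15) (by norm_num)
      (kronRect_twelve_pos_of_thirteen_le_sixteen (by norm_num) (by norm_num)),
    genericTensorMinimalDegree_sq_sub_eq (δ := 12) (j := 14) (by norm_num)
      (kronRect_twelve_pos_of_thirteen_le_sixteen (by norm_num) (by norm_num)),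
    genericTensorMinimalDegree_sq_sub_eq (δ := 12) (j := 13) (by norm_num)
      (kronRect_twelve_pos_of_thirteen_le_sixteen (by norm_num) (by norm_num)),
    genericTensorMinimalDegree_sq_sub_eq_prime_add_one (p := 11) (j := 12) (by norm_num) (by decide)
      (by norm_num),
    genericTensorMinimalDegree_sq_sub_eq_prime_add_one (p := 11) (j := 6) (by norm_num) (by decide)
      (by norm_num),
    genericTensorMinimalDegree_sq_sub_eq_prime_add_one (p := 11) (j := 1) (by norm_num) (by decide)
      (by norm_num),
    genericTensorMinimalDegree_sq_sub_eq_prime_add_one (p := 11) (j := 0) (by norm_num) (by decide)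
      (by norm_num)⟩

end Literature.Computability.AlgebraicComplexity

end
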